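import Summits.Parity.GeneralizedHardyLittlewood.Theorems.FordMaynardNoSieveConst0164NegWitness0164Numerics

/-!
# Route `FordMaynardNoSieveConst0164`, crux `NegWitness0164` (stmt-Parity-19102), line `birth`,
# stub `stub_tweakNeg0164`: enclosure layer, part 1 — the one-dimensional integral `J₃`

Helper file toward the certificate stub (K. Ford, J. Maynard, *On the theory of prime producing sieves*,
arXiv:2407.14368, §8).  The first numerical target (I') of `stub_tweakNeg0164_of_numerics` (`…Numerics`) contains
the explicit integral `J₃ = ∫_{(0,1]} 𝟙[ν ≤ t < 1/2] Φ(t)/t dt` (`ν = 41/250`; Ford–Maynard's `I₃ = −J₃/3`), with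
`Φ(t)/t = 2·log(1/(1−2t))/(t(1−t))` on `[ν, 1/2 − ν]` and `= 2·log((1−t−ν)/ν)/(t(1−t))` on `[1/2 − ν, 1/2]`.
This file provides the generic pieces of a certified LOWER bound for `J₃` (no numerics yet):

* `log_ge_of_sum_0164` — `log y ≥ 2 Σ_{k<n} z^{2k+1}/(2k+1)`, `z = (y−1)/(y+1)` (partial sums of the `artanh` series);
* `inv_mul_tangent_0164` — the tangent line of the convex `1/(t(1−t))` is a minorant;
* `J3_integral_eq_intervalIntegral_0164` — `J₃` as an interval integral over `[ν, 1/2]`;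
* `intervalIntegrable_piece_one/two_0164` — integrability on subintervals of the two ranges;
* `integral_quad_0164` — the exact integral of the quadratic minorant;
* `piece_one_0164` / `piece_two_0164` — **on a subinterval `[p,q]` of either range, `∫_p^q Φ(t)/t dt` is at least an
  explicit rational expression in certified lower bounds of one or two logarithms** (tangent line of the convex
  `log(1/(1−2t))`, resp. chord of the concave `log((1−t−ν)/ν)`, times the tangent line of `1/(t(1−t))`).

Def-free.  References: [FordMaynard2024PrimeSieves] arXiv:2407.14368, §8 (proof of Theorem 2.7 (c)).
-/

noncomputable section

open Finset MeasureTheory Set intervalIntegral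
open scoped Classical
open Literature.NumberTheory.Sieve Literature.NumberTheory.Sieve.FordMaynard

namespace Summit.Parity.GeneralizedHardyLittlewood.FordMaynardNoSieveConst0164NegWitness0164

/-! ### Logarithm lower bounds from the `artanh` series -/

/-- Partial sums of `log(1+a) = 2 Σ_k (a/(a+2))^{2k+1}/(2k+1)` (`a ≥ 0`, all terms nonnegative) are lower bounds.
[folklore] -/
theorem log_one_add_ge_sum_0164 {a : ℝ} (ha : 0 ≤ a) (n : ℕ) :
    ∑ k ∈ Finset.range n, (2 : ℝ) * (1 / (2 * k + 1)) * (a / (a + 2)) ^ (2 * k + 1) ≤ Real.log (1 + a) :=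
  sum_le_hasSum (Finset.range n) (fun k _ => by positivity) (Real.hasSum_log_one_add ha)

/-- **Certified logarithm lower bound**: if `y ≥ 1` and `ℓ ≤ 2 Σ_{k<n} z^{2k+1}/(2k+1)` with `z = (y−1)/(y+1)`, then
`ℓ ≤ log y`. [folklore] -/
theorem log_ge_of_sum_0164 {y ℓ : ℝ} (hy : 1 ≤ y) (n : ℕ)
    (h : ℓ ≤ ∑ k ∈ Finset.range n, (2 : ℝ) * (1 / (2 * k + 1)) * ((y - 1) / (y + 1)) ^ (2 * k + 1)) :
    ℓ ≤ Real.log y := by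
  have h1 := log_one_add_ge_sum_0164 (a := y - 1) (by linarith) n
  have e : (y - 1) / (y - 1 + 2) = (y - 1) / (y + 1) := by congr 1; ring
  have e' : (1 : ℝ) + (y - 1) = y := by ring
  simp_rw [e, e'] at h1
  exact h.trans h1

/-! ### Elementary minorants -/

/-- The tangent line at `c` of the convex function `t ↦ 1/(t(1−t))` on `(0,1)` lies below it. [folklore] -/
theorem inv_mul_tangent_0164 {t c : ℝ} (ht : 0 < t) (ht1 : t < 1) (hc : 0 < c) (hc1 : c < 1) :
    1 / (c * (1 - c)) + (-(1 - 2 * c) / (c * (1 - c)) ^ 2) * (t - c) ≤ 1 / (t * (1 - t)) := by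
  have hD : 0 < t * (1 - t) := mul_pos ht (by linarith)
  have hE : 0 < c * (1 - c) := mul_pos hc (by linarith)
  have hD' := hD.ne'
  have hE' := hE.ne'
  have ht' : t ≠ 0 := ht.ne'
  have hc' : c ≠ 0 := hc.ne'
  have h1t : 1 - t ≠ 0 := ne_of_gt (by linarith)
  have h1c : 1 - c ≠ 0 := ne_of_gt (by linarith)
  rw [← sub_nonneg]
  have key : 1 / (t * (1 - t)) - (1 / (c * (1 - c)) + (-(1 - 2 * c) / (c * (1 - c)) ^ 2) * (t - c)) =
      ((t * (1 - t) - c * (1 - c)) ^ 2 + t * (1 - t) * (t - c) ^ 2) / (t * (1 - t) * (c * (1 - c)) ^ 2) := by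
    field_simp
    ring
  rw [key]
  positivity

/-- The tangent line at `c` of the convex function `t ↦ log(1/(1−2t))` on `(−∞, 1/2)` lies below it (from
`log x ≤ x − 1`). [folklore] -/
theorem log_tangent_0164 {t c : ℝ} (ht : t < 1 / 2) (hc : c < 1 / 2) :
    Real.log (1 / (1 - 2 * c)) + 2 / (1 - 2 * c) * (t - c) ≤ Real.log ((1 / 2) / (1 - t - 1 / 2)) := by
  have h2t : (0 : ℝ) < 1 - t - 1 / 2 := by linarith
  have h2c : (0 : ℝ) < 1 - 2 * c := by linarith
  have hYt : 0 < (1 / 2 : ℝ) / (1 - t - 1 / 2) := div_pos (by norm_num) h2t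
  have hYc : 0 < (1 : ℝ) / (1 - 2 * c) := div_pos (by norm_num) h2c
  have h := Real.log_le_sub_one_of_pos (div_pos hYc hYt)
  rw [Real.log_div hYc.ne' hYt.ne'] at h
  have e : (1 : ℝ) / (1 - 2 * c) / ((1 / 2) / (1 - t - 1 / 2)) - 1 = -(2 / (1 - 2 * c) * (t - c)) := by
    field_simp
    ring
  rw [e] at h
  linarith

/-- Chord inequality for the concave function `t ↦ log((1−t−ν)/ν)` (`ν = 41/250`): on `[p,q]` the chord through the
endpoint values lies below the function (from `log x ≤ x − 1` twice). [folklore] -/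
theorem log_chord_0164 {p q t : ℝ} (hpt : p ≤ t) (htq : t ≤ q) (hpq : p < q) (hq : q < 1 - 41 / 250) :
    (q - t) * Real.log ((1 - p - 41 / 250) / (41 / 250)) + (t - p) * Real.log ((1 - q - 41 / 250) / (41 / 250)) ≤
      (q - p) * Real.log ((1 - t - 41 / 250) / (41 / 250)) := by
  have hUp : 0 < (1 - p - 41 / 250) / (41 / 250 : ℝ) := div_pos (by linarith) (by norm_num)
  have hUq : 0 < (1 - q - 41 / 250) / (41 / 250 : ℝ) := div_pos (by linarith) (by norm_num)
  have hUt : 0 < (1 - t - 41 / 250) / (41 / 250 : ℝ) := div_pos (by linarith) (by norm_num)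
  have h1 := Real.log_le_sub_one_of_pos (div_pos hUp hUt)
  have h2 := Real.log_le_sub_one_of_pos (div_pos hUq hUt)
  rw [Real.log_div hUp.ne' hUt.ne'] at h1
  rw [Real.log_div hUq.ne' hUt.ne'] at h2
  have hne : (1 - t - 41 / 250 : ℝ) ≠ 0 := ne_of_gt (by linarith)
  rw [div_div_div_cancel_right₀ (by norm_num : (41 / 250 : ℝ) ≠ 0), div_sub_one hne] at h1 h2
  have e : (q - t) * ((1 - p - 41 / 250 - (1 - t - 41 / 250)) / (1 - t - 41 / 250)) +
      (t - p) * ((1 - q - 41 / 250 - (1 - t - 41 / 250)) / (1 - t - 41 / 250)) = 0 := by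
    ring
  have h1' := mul_le_mul_of_nonneg_left h1 (by linarith : (0 : ℝ) ≤ q - t)
  have h2' := mul_le_mul_of_nonneg_left h2 (by linarith : (0 : ℝ) ≤ t - p)
  linarith

/-- The two logarithms of the first range combine: `log((1/2)/(1−t−1/2)) − log((1−t−1/2)/(1−t−(1−t−1/2)))
= 2·log((1/2)/(1−t−1/2))`. [folklore] -/
theorem branch_one_eq_0164 (t : ℝ) :
    Real.log ((1 / 2) / (1 - t - 1 / 2)) - Real.log ((1 - t - 1 / 2) / (1 - t - (1 - t - 1 / 2))) =
      2 * Real.log ((1 / 2) / (1 - t - 1 / 2)) := by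
  have h1 : (1 - t - 1 / 2) / (1 - t - (1 - t - 1 / 2)) = ((1 / 2 : ℝ) / (1 - t - 1 / 2))⁻¹ := by
    rw [inv_div]; congr 1; ring
  rw [h1, Real.log_inv]; ring

/-- The two logarithms of the second range combine: `log((1−t−ν)/(1−t−(1−t−ν))) − log(ν/(1−t−ν))
= 2·log((1−t−ν)/ν)` (`ν = 41/250`). [folklore] -/
theorem branch_two_eq_0164 (t : ℝ) :
    Real.log ((1 - t - 41 / 250) / (1 - t - (1 - t - 41 / 250))) - Real.log ((41 / 250) / (1 - t - 41 / 250)) =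
      2 * Real.log ((1 - t - 41 / 250) / (41 / 250)) := by
  have h1 : (1 - t - 41 / 250) / (1 - t - (1 - t - 41 / 250)) = (1 - t - 41 / 250) / (41 / 250 : ℝ) := by
    congr 1; ring
  have h2 : (41 / 250 : ℝ) / (1 - t - 41 / 250) = ((1 - t - 41 / 250) / (41 / 250))⁻¹ := by rw [inv_div]
  rw [h1, h2, Real.log_inv]; ring

/-! ### `J₃` as an interval integral -/

/-- **`J₃` as an interval integral over `[ν, 1/2]`** (the indicator restricts the domain; endpoints are null).
[cite: FordMaynard2024PrimeSieves, §8] -/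
theorem J3_integral_eq_intervalIntegral_0164 :
    (∫ t in Ioc (0 : ℝ) 1, (if (41 / 250 : ℝ) ≤ t ∧ t < 1 / 2 then
        1 / t * (if 1 / 2 + 41 / 250 ≤ 1 - t then
          (Real.log ((1 / 2) / (1 - t - 1 / 2)) - Real.log ((1 - t - 1 / 2) / (1 - t - (1 - t - 1 / 2)))) / (1 - t)
        else (Real.log ((1 - t - 41 / 250) / (1 - t - (1 - t - 41 / 250))) -
          Real.log ((41 / 250) / (1 - t - 41 / 250))) / (1 - t)) else 0)) =
      ∫ t in (41 / 250 : ℝ)..(1 / 2), 1 / t * (if 1 / 2 + 41 / 250 ≤ 1 - t then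
          (Real.log ((1 / 2) / (1 - t - 1 / 2)) - Real.log ((1 - t - 1 / 2) / (1 - t - (1 - t - 1 / 2)))) / (1 - t)
        else (Real.log ((1 - t - 41 / 250) / (1 - t - (1 - t - 41 / 250))) -
          Real.log ((41 / 250) / (1 - t - 41 / 250))) / (1 - t)) := by
  set Ψ : ℝ → ℝ := fun t => 1 / t * (if 1 / 2 + 41 / 250 ≤ 1 - t then
          (Real.log ((1 / 2) / (1 - t - 1 / 2)) - Real.log ((1 - t - 1 / 2) / (1 - t - (1 - t - 1 / 2)))) / (1 - t)
        else (Real.log ((1 - t - 41 / 250) / (1 - t - (1 - t - 41 / 250))) -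
          Real.log ((41 / 250) / (1 - t - 41 / 250))) / (1 - t)) with hΨ
  have hind : (fun t : ℝ => if (41 / 250 : ℝ) ≤ t ∧ t < 1 / 2 then Ψ t else 0) =
      (Set.Ico (41 / 250 : ℝ) (1 / 2)).indicator Ψ := by
    funext t
    by_cases h : (41 / 250 : ℝ) ≤ t ∧ t < 1 / 2
    · rw [if_pos h, Set.indicator_of_mem (Set.mem_Ico.mpr h)]
    · rw [if_neg h, Set.indicator_of_notMem (fun hm => h (Set.mem_Ico.mp hm))]
  have hset : Set.Ioc (0 : ℝ) 1 ∩ Set.Ico (41 / 250 : ℝ) (1 / 2) = Set.Ico (41 / 250) (1 / 2) := by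
    ext t
    simp only [Set.mem_inter_iff, Set.mem_Ioc, Set.mem_Ico]
    constructor
    · intro h; exact h.2
    · intro h; exact ⟨⟨by linarith [h.1], by linarith [h.2]⟩, h⟩
  change (∫ t in Ioc (0 : ℝ) 1, (fun t : ℝ => if (41 / 250 : ℝ) ≤ t ∧ t < 1 / 2 then Ψ t else 0) t) =
    ∫ t in (41 / 250 : ℝ)..(1 / 2), Ψ t
  rw [hind, setIntegral_indicator measurableSet_Ico, hset, integral_Ico_eq_integral_Ioo,
    ← integral_Ioc_eq_integral_Ioo, ← intervalIntegral.integral_of_le (by norm_num)]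

/-! ### Integrability on subintervals -/

/-- On `[p,q] ⊂ [ν, 1/2 − ν]` the integrand `Φ(t)/t` (first range) is interval integrable. [folklore] -/
theorem intervalIntegrable_piece_one_0164 {p q : ℝ} (hp : 41 / 250 ≤ p) (hpq : p ≤ q)
    (hq : q ≤ 1 / 2 - 41 / 250) :
    IntervalIntegrable (fun t : ℝ => 1 / t * (if 1 / 2 + 41 / 250 ≤ 1 - t then
          (Real.log ((1 / 2) / (1 - t - 1 / 2)) - Real.log ((1 - t - 1 / 2) / (1 - t - (1 - t - 1 / 2)))) / (1 - t)
        else (Real.log ((1 - t - 41 / 250) / (1 - t - (1 - t - 41 / 250))) -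
          Real.log ((41 / 250) / (1 - t - 41 / 250))) / (1 - t))) volume p q := by
  have hcont : ContinuousOn (fun t : ℝ => 1 / t * ((Real.log ((1 / 2) / (1 - t - 1 / 2)) -
      Real.log ((1 - t - 1 / 2) / (1 - t - (1 - t - 1 / 2)))) / (1 - t))) (Icc p q) := by
    have hall : ∀ t ∈ Icc p q, 0 < t ∧ 0 < 1 - t - 1 / 2 ∧ 0 < 1 - t := by
      intro t ht
      exact ⟨by linarith [ht.1], by linarith [ht.2], by linarith [ht.2]⟩
    refine ContinuousOn.mul (continuousOn_const.div continuousOn_id fun t ht => (hall t ht).1.ne') ?_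
    refine ContinuousOn.div ?_ (by fun_prop) fun t ht => (hall t ht).2.2.ne'
    refine ContinuousOn.sub ?_ ?_
    · refine ContinuousOn.log (continuousOn_const.div (by fun_prop) fun t ht => (hall t ht).2.1.ne') ?_
      intro t ht
      exact (div_pos (by norm_num) (hall t ht).2.1).ne'
    · refine ContinuousOn.log (ContinuousOn.div (by fun_prop) (by fun_prop) ?_) ?_
      · intro t _; norm_num
      · intro t ht
        have : (1 - t - (1 - t - 1 / 2) : ℝ) = 1 / 2 := by ring
        rw [this]
        exact (div_pos (hall t ht).2.1 (by norm_num)).ne'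
  rw [intervalIntegrable_iff_integrableOn_Ioc_of_le hpq]
  refine (hcont.integrableOn_Icc.mono_set Ioc_subset_Icc_self).congr_fun (fun t ht => ?_) measurableSet_Ioc
  have hcond : (1 / 2 + 41 / 250 : ℝ) ≤ 1 - t := by linarith [ht.2]
  simp only [if_pos hcond]

/-- On `[p,q] ⊂ [1/2 − ν, 1/2]` the integrand `Φ(t)/t` (second range off the left endpoint) is interval integrable.
[folklore] -/
theorem intervalIntegrable_piece_two_0164 {p q : ℝ} (hp : 1 / 2 - 41 / 250 ≤ p) (hpq : p ≤ q) (hq : q ≤ 1 / 2) :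
    IntervalIntegrable (fun t : ℝ => 1 / t * (if 1 / 2 + 41 / 250 ≤ 1 - t then
          (Real.log ((1 / 2) / (1 - t - 1 / 2)) - Real.log ((1 - t - 1 / 2) / (1 - t - (1 - t - 1 / 2)))) / (1 - t)
        else (Real.log ((1 - t - 41 / 250) / (1 - t - (1 - t - 41 / 250))) -
          Real.log ((41 / 250) / (1 - t - 41 / 250))) / (1 - t))) volume p q := by
  have hcont : ContinuousOn (fun t : ℝ => 1 / t * ((Real.log ((1 - t - 41 / 250) / (1 - t - (1 - t - 41 / 250))) -
      Real.log ((41 / 250) / (1 - t - 41 / 250))) / (1 - t))) (Icc p q) := by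
    have hall : ∀ t ∈ Icc p q, 0 < t ∧ 0 < 1 - t - 41 / 250 ∧ 0 < 1 - t := by
      intro t ht
      exact ⟨by linarith [ht.1], by linarith [ht.2], by linarith [ht.2]⟩
    refine ContinuousOn.mul (continuousOn_const.div continuousOn_id fun t ht => (hall t ht).1.ne') ?_
    refine ContinuousOn.div ?_ (by fun_prop) fun t ht => (hall t ht).2.2.ne'
    refine ContinuousOn.sub ?_ ?_
    · refine ContinuousOn.log (ContinuousOn.div (by fun_prop) (by fun_prop) ?_) ?_
      · intro t _
        have : (1 - t - (1 - t - 41 / 250) : ℝ) = 41 / 250 := by ring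
        rw [this]; norm_num
      · intro t ht
        have : (1 - t - (1 - t - 41 / 250) : ℝ) = 41 / 250 := by ring
        rw [this]
        exact (div_pos (hall t ht).2.1 (by norm_num)).ne'
    · refine ContinuousOn.log (continuousOn_const.div (by fun_prop) fun t ht => (hall t ht).2.1.ne') ?_
      intro t ht
      exact (div_pos (by norm_num) (hall t ht).2.1).ne'
  rw [intervalIntegrable_iff_integrableOn_Ioc_of_le hpq]
  refine (hcont.integrableOn_Icc.mono_set Ioc_subset_Icc_self).congr_fun (fun t ht => ?_) measurableSet_Ioc
  have hcond : ¬ ((1 / 2 + 41 / 250 : ℝ) ≤ 1 - t) := by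
    intro h; linarith [ht.1]
  simp only [if_neg hcond]

/-! ### The quadratic minorant integrates exactly -/

/-- `∫_p^q 2(α₀ + α₁(t−c))(g₀ + g₁(t−c)) dt = 2(α₀g₀(q−p) + α₁g₁(q−p)³/12)` for the midpoint `c = (p+q)/2`.
[folklore] -/
theorem integral_quad_0164 (p q c α₀ α₁ g₀ g₁ : ℝ) (hc : p + q = 2 * c) :
    (∫ t in p..q, 2 * ((α₀ + α₁ * (t - c)) * (g₀ + g₁ * (t - c)))) =
      2 * (α₀ * g₀ * (q - p) + α₁ * g₁ * (q - p) ^ 3 / 12) := by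
  have hderiv : ∀ t, HasDerivAt (fun x : ℝ => 2 * (α₀ * g₀ * (x - c) + (α₀ * g₁ + α₁ * g₀) * (x - c) ^ 2 / 2 +
      α₁ * g₁ * (x - c) ^ 3 / 3)) (2 * ((α₀ + α₁ * (t - c)) * (g₀ + g₁ * (t - c)))) t := by
    intro t
    have h1 : HasDerivAt (fun x : ℝ => x - c) 1 t := (hasDerivAt_id t).sub_const c
    exact ((((h1.const_mul (α₀ * g₀)).add (((h1.pow 2).const_mul (α₀ * g₁ + α₁ * g₀)).div_const 2)).add
      (((h1.pow 3).const_mul (α₁ * g₁)).div_const 3)).const_mul 2).congr_deriv (by push_cast; ring)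
  rw [intervalIntegral.integral_eq_sub_of_hasDerivAt (fun t _ => hderiv t)
    ((by fun_prop : Continuous fun t : ℝ => 2 * ((α₀ + α₁ * (t - c)) * (g₀ + g₁ * (t - c)))).intervalIntegrable
      _ _)]
  have hqc : q - c = (q - p) / 2 := by linarith
  have hpc : p - c = -((q - p) / 2) := by linarith
  simp only [hqc, hpc]
  ring

/-! ### The two per-interval lower bounds -/

/-- **Per-interval lower bound, first range.** For `[p,q] ⊂ [ν, 1/2 − ν]` with midpoint `c`, a certified
`ℓ ≤ log(1/(1−2c))` and the two (rational) side conditions making both tangent minorants nonnegative,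
`∫_p^q Φ(t)/t dt ≥ 2(ℓ·g₀·(q−p) + (2/(1−2c))·g₁·(q−p)³/12)`, `g₀ = 1/(c(1−c))`, `g₁ = −(1−2c)/(c(1−c))²`.
[cite: FordMaynard2024PrimeSieves, §8 (proof of Theorem 2.7 (c))] -/
theorem piece_one_0164 {p q c ℓ B : ℝ} (hp : 41 / 250 ≤ p) (hpq : p < q) (hq : q ≤ 1 / 2 - 41 / 250)
    (hc : p + q = 2 * c) (hℓ : ℓ ≤ Real.log (1 / (1 - 2 * c)))
    (hℓpos : 0 ≤ ℓ - 2 / (1 - 2 * c) * ((q - p) / 2))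
    (hg : 0 ≤ 1 / (c * (1 - c)) + (-(1 - 2 * c) / (c * (1 - c)) ^ 2) * ((q - p) / 2))
    (hB : B ≤ 2 * (ℓ * (1 / (c * (1 - c))) * (q - p) +
      (2 / (1 - 2 * c)) * (-(1 - 2 * c) / (c * (1 - c)) ^ 2) * (q - p) ^ 3 / 12)) :
    B ≤ ∫ t in p..q, 1 / t * (if 1 / 2 + 41 / 250 ≤ 1 - t then
          (Real.log ((1 / 2) / (1 - t - 1 / 2)) - Real.log ((1 - t - 1 / 2) / (1 - t - (1 - t - 1 / 2)))) / (1 - t)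
        else (Real.log ((1 - t - 41 / 250) / (1 - t - (1 - t - 41 / 250))) -
          Real.log ((41 / 250) / (1 - t - 41 / 250))) / (1 - t)) := by
  have hc0 : 0 < c := by linarith
  have hc1 : c < 1 / 2 := by linarith
  have hs : 0 ≤ 2 / (1 - 2 * c) := div_nonneg (by norm_num) (by linarith)
  have hg1 : -(1 - 2 * c) / (c * (1 - c)) ^ 2 ≤ 0 :=
    div_nonpos_of_nonpos_of_nonneg (by linarith) (by positivity)
  have hmono : (∫ t in p..q, 2 * ((ℓ + 2 / (1 - 2 * c) * (t - c)) *
      (1 / (c * (1 - c)) + (-(1 - 2 * c) / (c * (1 - c)) ^ 2) * (t - c)))) ≤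
      ∫ t in p..q, 1 / t * (if 1 / 2 + 41 / 250 ≤ 1 - t then
          (Real.log ((1 / 2) / (1 - t - 1 / 2)) - Real.log ((1 - t - 1 / 2) / (1 - t - (1 - t - 1 / 2)))) / (1 - t)
        else (Real.log ((1 - t - 41 / 250) / (1 - t - (1 - t - 41 / 250))) -
          Real.log ((41 / 250) / (1 - t - 41 / 250))) / (1 - t)) := by
    refine intervalIntegral.integral_mono_on_of_le_Ioo hpq.le
      ((by fun_prop : Continuous fun t : ℝ => 2 * ((ℓ + 2 / (1 - 2 * c) * (t - c)) *
        (1 / (c * (1 - c)) + (-(1 - 2 * c) / (c * (1 - c)) ^ 2) * (t - c)))).intervalIntegrable _ _)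
      (intervalIntegrable_piece_one_0164 hp hpq.le hq) fun t ht => ?_
    have ht0 : 0 < t := by linarith [ht.1]
    have ht1 : t < 1 / 2 := by linarith [ht.2]
    have hcond : (1 / 2 + 41 / 250 : ℝ) ≤ 1 - t := by linarith [ht.2]
    rw [if_pos hcond, branch_one_eq_0164]
    have hlog : ℓ + 2 / (1 - 2 * c) * (t - c) ≤ Real.log ((1 / 2) / (1 - t - 1 / 2)) :=
      le_trans (by linarith) (log_tangent_0164 ht1 hc1)
    have hinv := inv_mul_tangent_0164 (c := c) ht0 (by linarith) hc0 (by linarith)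
    have hm1 : 0 ≤ ℓ + 2 / (1 - 2 * c) * (t - c) := by
      have : 2 / (1 - 2 * c) * (-((q - p) / 2)) ≤ 2 / (1 - 2 * c) * (t - c) :=
        mul_le_mul_of_nonneg_left (by linarith [ht.1]) hs
      linarith
    have hm2 : 0 ≤ 1 / (c * (1 - c)) + (-(1 - 2 * c) / (c * (1 - c)) ^ 2) * (t - c) := by
      have : (-(1 - 2 * c) / (c * (1 - c)) ^ 2) * ((q - p) / 2) ≤
          (-(1 - 2 * c) / (c * (1 - c)) ^ 2) * (t - c) :=
        mul_le_mul_of_nonpos_left (by linarith [ht.2]) hg1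
      linarith
    have hL0 : 0 ≤ Real.log ((1 / 2) / (1 - t - 1 / 2)) := le_trans hm1 hlog
    calc 2 * ((ℓ + 2 / (1 - 2 * c) * (t - c)) * (1 / (c * (1 - c)) + (-(1 - 2 * c) / (c * (1 - c)) ^ 2) * (t - c)))
        ≤ 2 * (Real.log ((1 / 2) / (1 - t - 1 / 2)) * (1 / (t * (1 - t)))) :=
          mul_le_mul_of_nonneg_left (mul_le_mul hlog hinv hm2 hL0) (by norm_num)
      _ = 1 / t * (2 * Real.log ((1 / 2) / (1 - t - 1 / 2)) / (1 - t)) := by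
          rw [← one_div_mul_one_div]; ring
  rw [integral_quad_0164 p q c _ _ _ _ hc] at hmono
  exact hB.trans hmono

/-- **Per-interval lower bound, second range.** For `[p,q] ⊂ [1/2 − ν, 1/2]` with midpoint `c`, certified
`0 ≤ ℓp ≤ log((1−p−ν)/ν)`, `0 ≤ ℓq ≤ log((1−q−ν)/ν)` and the side condition making the tangent minorant of
`1/(t(1−t))` nonnegative, `∫_p^q Φ(t)/t dt ≥ 2((ℓp+ℓq)/2·g₀·(q−p) + ((ℓq−ℓp)/(q−p))·g₁·(q−p)³/12)`.
[cite: FordMaynard2024PrimeSieves, §8 (proof of Theorem 2.7 (c))] -/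
theorem piece_two_0164 {p q c ℓp ℓq B : ℝ} (hp : 1 / 2 - 41 / 250 ≤ p) (hpq : p < q) (hq : q ≤ 1 / 2)
    (hc : p + q = 2 * c) (hℓp : ℓp ≤ Real.log ((1 - p - 41 / 250) / (41 / 250)))
    (hℓq : ℓq ≤ Real.log ((1 - q - 41 / 250) / (41 / 250))) (hℓp0 : 0 ≤ ℓp) (hℓq0 : 0 ≤ ℓq)
    (hg : 0 ≤ 1 / (c * (1 - c)) + (-(1 - 2 * c) / (c * (1 - c)) ^ 2) * ((q - p) / 2))
    (hB : B ≤ 2 * ((ℓp + ℓq) / 2 * (1 / (c * (1 - c))) * (q - p) +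
      ((ℓq - ℓp) / (q - p)) * (-(1 - 2 * c) / (c * (1 - c)) ^ 2) * (q - p) ^ 3 / 12)) :
    B ≤ ∫ t in p..q, 1 / t * (if 1 / 2 + 41 / 250 ≤ 1 - t then
          (Real.log ((1 / 2) / (1 - t - 1 / 2)) - Real.log ((1 - t - 1 / 2) / (1 - t - (1 - t - 1 / 2)))) / (1 - t)
        else (Real.log ((1 - t - 41 / 250) / (1 - t - (1 - t - 41 / 250))) -
          Real.log ((41 / 250) / (1 - t - 41 / 250))) / (1 - t)) := by
  have hc0 : 0 < c := by linarith
  have hc1 : c < 1 := by linarith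
  have hh : 0 < q - p := by linarith
  have hg1 : -(1 - 2 * c) / (c * (1 - c)) ^ 2 ≤ 0 :=
    div_nonpos_of_nonpos_of_nonneg (by linarith) (by positivity)
  have hmono : (∫ t in p..q, 2 * (((ℓp + ℓq) / 2 + (ℓq - ℓp) / (q - p) * (t - c)) *
      (1 / (c * (1 - c)) + (-(1 - 2 * c) / (c * (1 - c)) ^ 2) * (t - c)))) ≤
      ∫ t in p..q, 1 / t * (if 1 / 2 + 41 / 250 ≤ 1 - t then
          (Real.log ((1 / 2) / (1 - t - 1 / 2)) - Real.log ((1 - t - 1 / 2) / (1 - t - (1 - t - 1 / 2)))) / (1 - t)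
        else (Real.log ((1 - t - 41 / 250) / (1 - t - (1 - t - 41 / 250))) -
          Real.log ((41 / 250) / (1 - t - 41 / 250))) / (1 - t)) := by
    refine intervalIntegral.integral_mono_on_of_le_Ioo hpq.le
      ((by fun_prop : Continuous fun t : ℝ => 2 * (((ℓp + ℓq) / 2 + (ℓq - ℓp) / (q - p) * (t - c)) *
        (1 / (c * (1 - c)) + (-(1 - 2 * c) / (c * (1 - c)) ^ 2) * (t - c)))).intervalIntegrable _ _)
      (intervalIntegrable_piece_two_0164 hp hpq.le hq) fun t ht => ?_
    have ht0 : 0 < t := by linarith [ht.1]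
    have ht1 : t < 1 / 2 := by linarith [ht.2]
    have hcond : ¬ ((1 / 2 + 41 / 250 : ℝ) ≤ 1 - t) := by intro h; linarith [ht.1]
    rw [if_neg hcond, branch_two_eq_0164]
    -- the chord minorant
    have hchord := log_chord_0164 ht.1.le ht.2.le hpq (by linarith)
    have hsum : (q - t) * ℓp + (t - p) * ℓq ≤ (q - p) * Real.log ((1 - t - 41 / 250) / (41 / 250)) := by
      have h1 := mul_le_mul_of_nonneg_left hℓp (by linarith [ht.2] : (0 : ℝ) ≤ q - t)
      have h2 := mul_le_mul_of_nonneg_left hℓq (by linarith [ht.1] : (0 : ℝ) ≤ t - p)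
      linarith
    have hform : (ℓp + ℓq) / 2 + (ℓq - ℓp) / (q - p) * (t - c) = ((q - t) * ℓp + (t - p) * ℓq) / (q - p) := by
      field_simp
      nlinarith [hc]
    have hlog : (ℓp + ℓq) / 2 + (ℓq - ℓp) / (q - p) * (t - c) ≤ Real.log ((1 - t - 41 / 250) / (41 / 250)) := by
      rw [hform, div_le_iff₀ hh]
      linarith
    have hm1 : 0 ≤ (ℓp + ℓq) / 2 + (ℓq - ℓp) / (q - p) * (t - c) := by
      rw [hform]
      apply div_nonneg _ hh.le
      nlinarith [ht.1, ht.2]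
    have hinv := inv_mul_tangent_0164 (c := c) ht0 (by linarith) hc0 hc1
    have hm2 : 0 ≤ 1 / (c * (1 - c)) + (-(1 - 2 * c) / (c * (1 - c)) ^ 2) * (t - c) := by
      have : (-(1 - 2 * c) / (c * (1 - c)) ^ 2) * ((q - p) / 2) ≤
          (-(1 - 2 * c) / (c * (1 - c)) ^ 2) * (t - c) :=
        mul_le_mul_of_nonpos_left (by linarith [ht.2]) hg1
      linarith
    have hL0 : 0 ≤ Real.log ((1 - t - 41 / 250) / (41 / 250)) := le_trans hm1 hlog
    calc 2 * (((ℓp + ℓq) / 2 + (ℓq - ℓp) / (q - p) * (t - c)) *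
          (1 / (c * (1 - c)) + (-(1 - 2 * c) / (c * (1 - c)) ^ 2) * (t - c)))
        ≤ 2 * (Real.log ((1 - t - 41 / 250) / (41 / 250)) * (1 / (t * (1 - t)))) :=
          mul_le_mul_of_nonneg_left (mul_le_mul hlog hinv hm2 hL0) (by norm_num)
      _ = 1 / t * (2 * Real.log ((1 - t - 41 / 250) / (41 / 250)) / (1 - t)) := by
          rw [← one_div_mul_one_div]; ring
  rw [integral_quad_0164 p q c _ _ _ _ hc] at hmono
  exact hB.trans hmono

end Summit.Parity.GeneralizedHardyLittlewood.FordMaynardNoSieveConst0164NegWitness0164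

end
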